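import Summits.ResolutionOfSingularities.ResolutionOfSingularities.Theorems.FrobeniusLadderFRationalResolutionPrimaryCentreEtale
import Mathlib.AlgebraicGeometry.Morphisms.Flat
import HarnessLib

/-!
# Crux `FrobeniusLadder.FRationalResolution` (stmt-ResolutionOfSingularities-15317), line `redirect`,
# stub `stub_diagonalizableQuotientResolution` — the DESCENDED PRIMARY PIECE together with its FLAT CHART COVER and the
# CENTRE EQUATION `I C_g = J C_g` (the data `…DescendedPrimaryPiece.exists_descended_primary_piece` proves and then forgets)

`…DescendedPrimaryPiece.exists_descended_primary_piece` (✓p833685) returns, from an étale-type chart `B → C` with a trivial-residue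
point `𝔔` over `𝔭` and a `𝔔`-primary centre `J` of regular blow-up, a `𝔭`-primary ideal `I` and a basic open `D(h) ∋ 𝔭` with
`Bl_{I B_h}` regular — and discards HOW: a basic open `D(g) ∋ 𝔔` of the chart over which `𝔔` is the reduced fibre of `𝔭` and
`I C_g = J C_g`, with `D(h)` inside the (open) image of the flat `Spec C_g → Spec B`. The Galois route's remaining obligation
(Cartier-ness of the twists `(1 ⊗ σ) I₁` on `Bl_{I₁}`, memo MEMO-15317-leafhand2-g13 §2) is to be checked AFTER the flat surjective
base change `B_h → C_{g h}` (`…BlowupCartierBaseChange`, ✓p835409), where the centre becomes `J C_{g h}`; for that the cover and the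
equation must be part of the OUTPUT. This file re-runs the same assembly and keeps them.

* `flat_specMap_awayMap`, `surjective_specMap_awayMap` — the localized chart map `B_h → C_{g h}` (`IsLocalization.Away.map`) is
  `Flat` and `Surjective` as a morphism of spectra when `C` is `B`-flat and `D(h) ⊆ im (Spec C_g → Spec B)` — exactly the instance
  hypotheses of `…BlowupCartierBaseChange.isEffectiveCartier_comap_affineBlowup_of_flat_surjective`.
* **`exists_descended_primary_piece_cover`** — `exists_descended_primary_piece` with the extra outputs
  `g ∉ 𝔔`, `𝔔 C_g ≤ 𝔭 C_g`, `I C_g = J C_g`, `D(h) ⊆ im (Spec C_g → Spec B)`.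
* `awayMap_comp_algebraMap`, `map_awayMap_eq` — bookkeeping: along `B → B_h → C_{g h}` the piece `I B_h` extends to `(J C_g) C_{g h}`.

Honest label: plumbing toward ONE leaf stub (no stub, crux or summit closed). No definitions, no named facts, no sorry.
[cite: StacksProject, Tag 00UW; Tag 02NS; Tag 00I1] [cite: GortzWedhorn2020, Prop. 13.91 (2)]
-/

noncomputable section

-- single-problem summit: the doubled namespace component is forced
set_option linter.dupNamespace false

open CategoryTheory AlgebraicGeometry TopologicalSpace
open Literature.AlgebraicGeometry.Resolution
open Summit.ResolutionOfSingularities.ResolutionOfSingularities.Theorems.FRationalResolution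

namespace Summit.ResolutionOfSingularities.ResolutionOfSingularities.Theorems.FRationalResolution.DescendedPrimaryPieceCover

open BlowupFlatCriteria FlatCoverLocalization

universe u

/-- **The localized chart map is flat**: for `C` flat over `B`, `B_h → C_h` (`IsLocalization.Away.map` to any localizations away
from `h`, resp. its image) is `Flat` as a morphism `Spec C_h → Spec B_h`. [folklore] -/
theorem flat_specMap_awayMap {B C : Type u} [CommRing B] [CommRing C] [Algebra B C] [Module.Flat B C] (h : B)
    (B' C' : Type u) [CommRing B'] [CommRing C'] [Algebra B B'] [Algebra C C']
    [IsLocalization.Away h B'] [IsLocalization.Away (algebraMap B C h) C'] :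
    Flat (Spec.map (CommRingCat.ofHom (IsLocalization.Away.map B' C' (algebraMap B C) h))) := by
  rw [HasRingHomProperty.Spec_iff (P := @Flat), CommRingCat.hom_ofHom]
  exact flat_awayMap B C (RingHom.flat_algebraMap_iff.mpr inferInstance) h B' C'

/-- **The localized chart map is surjective on spectra** when `D(h) ⊆ im (Spec C → Spec B)`. [folklore] -/
theorem surjective_specMap_awayMap {B C : Type u} [CommRing B] [CommRing C] [Algebra B C] (h : B)
    (hsub : (PrimeSpectrum.basicOpen h : Set (PrimeSpectrum B)) ⊆
      Set.range (PrimeSpectrum.comap (algebraMap B C)))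
    (B' C' : Type u) [CommRing B'] [CommRing C'] [Algebra B B'] [Algebra C C']
    [IsLocalization.Away h B'] [IsLocalization.Away (algebraMap B C h) C'] :
    Surjective (Spec.map (CommRingCat.ofHom (IsLocalization.Away.map B' C' (algebraMap B C) h))) := by
  refine ⟨fun x => ?_⟩
  obtain ⟨y, hy⟩ := comap_awayMap_surjective B C h hsub B' C' x
  exact ⟨y, hy⟩

/-- Bookkeeping: `B → B_h → C_{g h}` equals `B → C_g → C_{g h}` (with `C_g` any `B`-algebra here). [folklore] -/
theorem awayMap_comp_algebraMap {B Cg : Type u} [CommRing B] [CommRing Cg] [Algebra B Cg] (h : B)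
    (B' C' : Type u) [CommRing B'] [CommRing C'] [Algebra B B'] [Algebra Cg C']
    [IsLocalization.Away h B'] [IsLocalization.Away (algebraMap B Cg h) C'] :
    (IsLocalization.Away.map B' C' (algebraMap B Cg) h).comp (algebraMap B B') =
      (algebraMap Cg C').comp (algebraMap B Cg) := by
  rw [IsLocalization.Away.map, IsLocalization.map_comp]

/-- Bookkeeping: if `I C_g = J'` (`J'` an ideal of the `B`-algebra `C_g`), then along the localized chart map `B_h → C_{g h}` the
piece `I B_h` extends to `J' C_{g h}`. [folklore] -/
theorem map_awayMap_eq {B Cg : Type u} [CommRing B] [CommRing Cg] [Algebra B Cg] (h : B)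
    (B' C' : Type u) [CommRing B'] [CommRing C'] [Algebra B B'] [Algebra Cg C']
    [IsLocalization.Away h B'] [IsLocalization.Away (algebraMap B Cg h) C']
    (I : Ideal B) (J' : Ideal Cg) (hIJ : I.map (algebraMap B Cg) = J') :
    (I.map (algebraMap B B')).map (IsLocalization.Away.map B' C' (algebraMap B Cg) h) =
      J'.map (algebraMap Cg C') := by
  rw [Ideal.map_map, awayMap_comp_algebraMap, ← Ideal.map_map, hIJ]

/-- **The descended primary piece with its flat chart cover and centre equation.** Let `B` be Noetherian, `C` a flat finitely
presented `B`-algebra, `𝔭 ⊆ B` maximal, `𝔔 ⊆ C` maximal over `𝔭` with trivial residue extension (`every c ≡ some b mod 𝔔`) and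
`𝔭 C_𝔔 = 𝔪_{C_𝔔}`, and `J ⊆ C` with `𝔔ⁿ ⊆ J ⊆ 𝔔` whose blow-up `Bl_J(Spec C)` is regular. Then there are an ideal `I ⊆ B` with
`𝔭ⁿ ⊆ I ⊆ 𝔭`, an element `g ∉ 𝔔` with `𝔔 C_g ⊆ 𝔭 C_g` (over `D(g)` the fibre of `𝔭` is the reduced point `𝔔`) and
`I C_g = J C_g`, and an element `h ∉ 𝔭` with `D(h) ⊆ im (Spec C_g → Spec B)` (so `Spec C_{g h} → Spec B_h` is flat and
surjective) and `Bl_{I B_h}(Spec B_h)` regular. [cite: StacksProject, Tag 00UW; Tag 02NS; Tag 00I1]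
[cite: GortzWedhorn2020, Prop. 13.91 (2)] -/
theorem exists_descended_primary_piece_cover {B C : Type u} [CommRing B] [CommRing C] [Algebra B C] [IsNoetherianRing B]
    [Module.Flat B C] [Algebra.FinitePresentation B C]
    (𝔭 : Ideal B) [h𝔭 : 𝔭.IsMaximal] (𝔔 : Ideal C) [h𝔔 : 𝔔.IsMaximal] (hover : 𝔭 ≤ 𝔔.comap (algebraMap B C))
    (hres : ∀ c : C, ∃ b : B, c - algebraMap B C b ∈ 𝔔)
    (hunr : 𝔭.map (algebraMap B (Localization.AtPrime 𝔔)) =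
      IsLocalRing.maximalIdeal (Localization.AtPrime 𝔔))
    (J : Ideal C) {n : ℕ} (hJ : 𝔔 ^ n ≤ J) (hJ𝔔 : J ≤ 𝔔) (hregJ : Scheme.IsRegular (affineBlowup J)) :
    ∃ I : Ideal B, 𝔭 ^ n ≤ I ∧ I ≤ 𝔭 ∧
      ∃ g : C, g ∉ 𝔔 ∧
        𝔔.map (algebraMap C (Localization.Away g)) ≤ 𝔭.map (algebraMap B (Localization.Away g)) ∧
        I.map (algebraMap B (Localization.Away g)) = J.map (algebraMap C (Localization.Away g)) ∧
        ∃ h : B, h ∉ 𝔭 ∧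
          (PrimeSpectrum.basicOpen h : Set (PrimeSpectrum B)) ⊆
            Set.range (PrimeSpectrum.comap (algebraMap B (Localization.Away g))) ∧
          Scheme.IsRegular (affineBlowup (I.map (algebraMap B (Localization.Away h)))) := by
  haveI : Algebra.FiniteType B C := inferInstance
  haveI : IsNoetherianRing C := Algebra.FiniteType.isNoetherianRing B C
  -- over `D(g)` the fibre of `𝔭` is the reduced point `𝔔`
  obtain ⟨g, hg, hle⟩ := FibreReduced.exists_away_fibre_reduced 𝔭 𝔔 hunr
  set Cg := Localization.Away g with hCg
  haveI : Algebra.FinitePresentation B Cg :=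
    haveI := IsLocalization.Away.finitePresentation g (S := Cg)
    Algebra.FinitePresentation.trans B C Cg
  haveI : IsOpenImmersion (Spec.map (CommRingCat.ofHom (algebraMap C Cg))) := IsOpenImmersion.of_isLocalization g
  have halg : algebraMap B Cg = (algebraMap C Cg).comp (algebraMap B C) := IsScalarTower.algebraMap_eq B C _
  -- descend the centre
  obtain ⟨I, hpI, hIp, hIJ⟩ := CentreDescent.exists_descended_centre 𝔭 𝔔 hover hres g hg Cg hle J hJ hJ𝔔
  -- `Bl_{I C_g} = Bl_{J C_g}` is an open piece of `Bl_J`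
  have hregC : Scheme.IsRegular (affineBlowup (I.map (algebraMap B Cg))) := by
    rw [halg, hIJ]
    exact isRegular_affineBlowup_map_of_isOpenImmersion _ J hregJ
  -- `𝔭` lies under `𝔔 C_g`
  have hdisj : Disjoint ((Submonoid.powers g : Submonoid C) : Set C) (𝔔 : Set C) := by
    refine Set.disjoint_left.mpr ?_
    rintro x ⟨m, rfl⟩ hx
    exact hg (h𝔔.isPrime.mem_of_pow_mem m hx)
  haveI hQ'prime : (𝔔.map (algebraMap C Cg)).IsPrime :=
    IsLocalization.isPrime_of_isPrime_disjoint (Submonoid.powers g) _ 𝔔 h𝔔.isPrime hdisj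
  have hcomapQ : 𝔔.comap (algebraMap B C) = 𝔭 :=
    (h𝔭.eq_of_le (Ideal.IsPrime.ne_top inferInstance) hover).symm
  have h𝔭C : (⟨𝔭, h𝔭.isPrime⟩ : PrimeSpectrum B) ∈ Set.range (PrimeSpectrum.comap (algebraMap B Cg)) := by
    have hQQ : (𝔔.map (algebraMap C Cg)).comap (algebraMap C Cg) = 𝔔 :=
      IsLocalization.under_map_of_isPrime_disjoint (Submonoid.powers g) Cg h𝔔.isPrime hdisj
    refine ⟨⟨𝔔.map (algebraMap C Cg), hQ'prime⟩, ?_⟩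
    ext1
    change (𝔔.map (algebraMap C Cg)).comap (algebraMap B Cg) = 𝔭
    rw [halg, ← Ideal.comap_comap, hQQ]
    exact hcomapQ
  -- a basic open `D(h) ∋ 𝔭` inside the (open) image of the flat chart `Spec C_g → Spec B`
  obtain ⟨h, hh𝔭, hsub⟩ := exists_basicOpen_subset_range_comap B Cg ⟨𝔭, h𝔭.isPrime⟩ h𝔭C
  set B' := Localization.Away h with hB'
  set C' := Localization.Away (algebraMap B Cg h) with hC'
  set φ' : B' →+* C' := IsLocalization.Away.map B' C' (algebraMap B Cg) h with hφ'
  set I' : Ideal B' := I.map (algebraMap B B') with hI'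
  haveI : IsNoetherianRing B' := IsLocalization.isNoetherianRing (Submonoid.powers h) B' inferInstance
  have hflat : φ'.Flat := flat_awayMap B Cg (RingHom.flat_algebraMap_iff.mpr inferInstance) h B' C'
  have hsurj : Function.Surjective (PrimeSpectrum.comap φ') := comap_awayMap_surjective B Cg h hsub B' C'
  haveI : IsOpenImmersion (Spec.map (CommRingCat.ofHom (algebraMap Cg C'))) :=
    IsOpenImmersion.of_isLocalization (algebraMap B Cg h)
  have hregC' : Scheme.IsRegular (affineBlowup (I'.map φ')) := by
    rw [hI', map_awayMap_eq h B' C' I _ rfl]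
    exact isRegular_affineBlowup_map_of_isOpenImmersion (algebraMap Cg C') _ hregC
  refine ⟨I, hpI, hIp, g, hg, ?_, ?_, h, hh𝔭, hsub, isRegular_affineBlowup_of_flat_of_surjective φ' I' hflat hsurj hregC'⟩
  · rw [halg]; exact hle
  · rw [halg]; exact hIJ

end Summit.ResolutionOfSingularities.ResolutionOfSingularities.Theorems.FRationalResolution.DescendedPrimaryPieceCover

end
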